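import Summits.BirchSwinnertonDyer.Rank1Residual.O5.O5GlobalLine
import Summits.BirchSwinnertonDyer.Rank1Residual.O5.O5LocalShapeProofs
import Literature.NumberTheory.EllipticCurves.RootNumberTableThreeAdmissibleProofs
import HarnessLib

/-!
# O5 — T24 in its LOCAL-SIGN form: "the local root number at `3` reads the Kummer line"
# (cell `b2b-bsdres`, lane CLASS-CLOSURE, class O5, team o5; node T24ℓ — cc-typer-5 GEN 9's offer A-O5-21,
# FILED by cc-typer-5 GEN 10 on o5-r1 GEN 9's word "A-O5-21: FILE as offered, binders as quoted",
# `HOME/INBOX.md` 2026-08-21T19:13Z; TYPED, EVIDENCE-LABELLED, NOTHING ASSERTED; 0 Literature facts)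

HONEST FRAMING (cell `b2b-bsdres`, run/shared/lean/b2b/bsd-rank1-residual/, verbatim in every file): the goal of
the cell is to DELETE the COMBINATION-SHAPED residual classes of the Birch–Swinnerton-Dyer formula for ALL
analytic-rank `≤ 1` elliptic curves over `ℚ` — assembled STRICTLY from published theorems — so that the rank-`≤ 1`
remainder becomes exactly the CONSTRUCTION-SHAPED classes, which are TYPED (missing-input `Prop`s), NOT attempted.
This is not "finishing BSD". Lane CLASS-CLOSURE (`CLASS-CLOSURE-PLAN.md` §3.5 O5, deliverable (c) TRANSPORT: a
COMPARISON STATEMENT along a mod-3 CONGRUENCE with its printed / announced antecedent): research routes; no claim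
beyond the stated classes; census output is EVIDENCE, never a Literature fact; nothing is booked; no mark of
`RESIDUAL-MAP.md` moves. Closed unproved `def : Prop` nodes carry `@[conjecture]` (cc-lead ⟦gen22⟧ (8)(b)).

PROVENANCE / PLACEMENT (typer of record O5 §3.5). Text and declarations = the GEN 9 offer
`class-closure/typer-5/gen9/O5KummerLineLocalSign.offer-NOT-FILED.lean` (sha16 `e628baad76be783e`, farm rc 0) with
both declarations BYTE-IDENTICAL (binders as quoted to o5-r1); the only GEN 10 changes are this header and the two
docstring precisions marked "GEN 10". DEDUP (`lean search` / tree grep on both new names): none. Vocabulary reused,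
not re-declared: GEN 5's `IsKummerBasePointThree` / `KummerTorsorsAgreeAtThree` (`O5/O5KummerLine.lean`), GEN 7/8's
`IsCongruentModThree` / `IsCleanPairAwayFromThree` / T24c `KummerLineByRootNumberCongruentThree`
(`O5/O5GlobalLine.lean`), the tree Predicate `LocIrr` (`Additive/FouquetWanLocus.lean`), Literature's
`WeierstrassCurve.rootNumberThree` (Rizzo Table II `W₃` on the invariants; `RootNumberTableThree.lean`) and
`WeierstrassCurve.rootNumber` / `rootNumber_eq_one_or` (`RootNumber.lean`). Bib key `BurungaleKobayashiNakamuraOta2025`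
present in `references.bib` (harvest-1 C26). Audit advisory as for every node of the cell: the `@[conjecture]` node is
an obligation, the bridge is 'orphan' until a consumer imports it.

o5-r1 GEN 7's T24 (`gen7/T23-GLOBAL-LINE.md` §3.5) was left untyped because the tree's `localRootNumber` is junk at
additive `3`. harvest-2 E92 (5) (`gen43/E92-T23-check.md` dcbfb816c4c65b2e): the tree HAS a non-junk local sign at
`3`, `W.rootNumberThree` (Rizzo's Table II `W₃` column on the invariants of `W`; `RootNumberTableThree.lean`,
validated on 923 952 curves; = `W.fullTableLocalRootNumberAt v₃`), and E92 R10: the statement is a consequence of the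
PREPRINT theorem Burungale–Kobayashi–Nakamura–Ota arXiv:2508.17776 Thm 1.3 (4) (`κ_E = H¹_{−w_p(E)}(ℚ_p, E[p])` for
every `E/ℚ_p` with `E(ℚ_p)[p] = 0`) read through a mod-3 congruence (global `W[3] ≅ X[3]` ⟹ local). HONEST FRAMING as
in every file of the cell: an `@[conjecture]` node (ANNOUNCED / PREPRINT antecedent = OPEN by the lane's rule; o5-r1's
v2 Thms 1–4 + Kobayashi give an independent elementary proof on the four TAME supersingular classes); nothing asserted,
nothing booked, no mark of `RESIDUAL-MAP.md` moves; census = EVIDENCE (tame: T22 + Table II rows III `+1`, III* `+1`,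
I₀* `−1`; wild: P-K13 NOT RUN). 0 Literature facts.

## KERNEL STATUS (cc-typer-5 GEN 10 restamp 1, 2026-08-21T23:10Z; node statement byte-identical, tag unchanged)
`hw3` (Table II complete on curves over `ℚ`) is a THEOREM: `WeierstrassCurve.rootNumberThree_eq_one_or_eq_neg_one`
(x11b3-p5 GEN 11, Literature `RootNumberTableThreeAdmissibleProofs.lean` p304655, with the 24 row theorems of
`RootNumberTableThreeRowsProofs.lean` p303744) — the import is switched to that proof file (it re-exports
`RootNumberTableThree`) and the primed bridge `kummerLineByRootNumber_of_localSign'` drops the binder. T24ℓ itself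
(`KummerLineByLocalRootNumberThree`) stays `@[conjecture]` (P-K13 not run); nothing booked; no mark.
-/

open scoped Classical

open Polynomial WeierstrassCurve Literature.NumberTheory.EllipticCurves
  Summit.BirchSwinnertonDyer.Rank1Residual.Additive

namespace Summit.BirchSwinnertonDyer.Rank1Residual.O5

/-- **T24ℓ `KummerLineByLocalRootNumberThree` (o5-r1 GEN 7 T24 in the congruent setting, LOCAL-SIGN form; NO clean
hypothesis; ANNOUNCED antecedent [cite: BurungaleKobayashiNakamuraOta2025, Thm. 1.3 (4) (arXiv 2508.17776; PREPRINT)]).**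
For a mod-3 congruent pair `W, X` over `ℚ` with `W[3]` irreducible globally and locally at `3`, ANY reduction at `3`
on either side: the Kummer torsors at `3` agree (GEN 5's finite 3-adic test) iff the Table II local root numbers at
`3` agree, `W.rootNumberThree = X.rootNumberThree`. With C4′ (clean ⟹ equal local signs away from `3`, E92 R9 ✓ /
Nekovář 2015) and the product formula `rootNumber_eq_neg_finprod_fullTableLocalRootNumberAt` this gives T24c; with
the Tamagawa bits it gives T25♭'s sign form. Why it might fail: only with BKNO Thm 1.3 (4) or the congruence ⟹
local-isomorphism step (certified links only). STATUS (GEN 10): ANNOUNCED / PREPRINT antecedent ⇒ OPEN by the lane's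
rule; harvest-2 E95 (`gen43/E95-T25-check.md` ce214f7e025554d1) §2.3: "`κ_W = κ_X ⟺ w₃ equal` STILL holds for unclean
pairs, for a web-free reason — BKNO Thm 1.3 is LOCAL at `3`" (hence NO clean hypothesis here). [evidence: census cell O5, o5-r1 GEN 7/8: tame classes consistent with T22 + Kobayashi (III +1 / III* +1 / I₀* −1); wild pairs P-K13 not run] -/
@[conjecture] def KummerLineByLocalRootNumberThree : Prop :=
  ∀ (W X : WeierstrassCurve ℚ) [W.IsElliptic] [W.IsGloballyMinimal] [X.IsElliptic] [X.IsGloballyMinimal],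
    LocIrr W 3 → W.HasIrreducibleModPGaloisRep 3 → IsCongruentModThree W X →
      ∀ x y x' y' : ℚ_[3], IsKummerBasePointThree W x y → IsKummerBasePointThree X x' y' →
        (KummerTorsorsAgreeAtThree W X x x' ↔ W.rootNumberThree = X.rootNumberThree)

/-- **Bridge (PROVED bookkeeping): T24ℓ + "the away-from-3 sign ratio agrees" ⟹ T24c on clean pairs.** The
hypothesis `hC4` is C4′ of T23-GLOBAL-LINE.md packaged with the product formula: for a clean congruent pair the
products of the local signs away from `3` agree, i.e. `w(W)·w₃(W) = w(X)·w₃(X)`; `hw3` says Table II signs are signs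
(GEN 10 precision: `Rizzo.tableII` returns the junk value `0` only OFF its rows; that no elliptic curve over `ℚ` falls
off the rows is the COMPLETENESS of Table II — validated on 923 952 curves in `RootNumberTableThree.lean`; at typing
time not a tree theorem — hence an explicit binder, never hidden; it IS a tree theorem since x11b3-p5 GEN 11's
`WeierstrassCurve.rootNumberThree_eq_one_or_eq_neg_one` (p304655, Rizzo §1.2 admissible triplets) — see the primed
corollary below, which discharges it).
[folklore] -/
theorem kummerLineByRootNumber_of_localSign (h24 : KummerLineByLocalRootNumberThree)
    (hC4 : ∀ (W X : WeierstrassCurve ℚ) [W.IsElliptic] [W.IsGloballyMinimal] [X.IsElliptic] [X.IsGloballyMinimal],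
      LocIrr W 3 → W.HasIrreducibleModPGaloisRep 3 → IsCongruentModThree W X → IsCleanPairAwayFromThree W X →
        W.rootNumber * W.rootNumberThree = X.rootNumber * X.rootNumberThree)
    (hw3 : ∀ (W : WeierstrassCurve ℚ) [W.IsElliptic], W.rootNumberThree = 1 ∨ W.rootNumberThree = -1) :
    KummerLineByRootNumberCongruentThree := by
  intro W X _ _ _ _ hL hρ hcong hclean x y x' y' hx hx'
  rw [h24 W X hL hρ hcong x y x' y' hx hx']
  have hprod := hC4 W X hL hρ hcong hclean
  have hW := W.rootNumber_eq_one_or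
  have hX := X.rootNumber_eq_one_or
  have h3W := hw3 W
  have h3X := hw3 X
  constructor
  · intro h3
    rw [h3] at hprod
    rcases h3X with h | h <;> rw [h] at hprod <;> linarith
  · intro hw
    rw [hw] at hprod
    rcases hX with h | h <;> rw [h] at hprod <;> linarith

/-- **Bridge with `hw3` DISCHARGED (cc-typer-5 GEN 10 restamp 1): T24ℓ + the away-from-3 sign ratio ⟹ T24c on clean
pairs**, the completeness of Rizzo's Table II on elliptic curves over `ℚ` (`W₃ = ±1`) being now the KERNEL THEOREM
`WeierstrassCurve.rootNumberThree_eq_one_or_eq_neg_one` (x11b3-p5 GEN 11,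
`Literature/NumberTheory/EllipticCurves/RootNumberTableThreeAdmissibleProofs.lean` p304655: the valuation trichotomy of
`1728Δ = c₄³ − c₆²` puts every `(v₃c₄, v₃c₆, v₃Δ)` on a row of Table II). Only `h24` (the node) and `hC4` (C4′ of
T23, the local-sign bookkeeping away from `3`) remain. [cite: Rizzo2003, §1.2 and Table II (p. 4)] -/
theorem kummerLineByRootNumber_of_localSign' (h24 : KummerLineByLocalRootNumberThree)
    (hC4 : ∀ (W X : WeierstrassCurve ℚ) [W.IsElliptic] [W.IsGloballyMinimal] [X.IsElliptic] [X.IsGloballyMinimal],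
      LocIrr W 3 → W.HasIrreducibleModPGaloisRep 3 → IsCongruentModThree W X → IsCleanPairAwayFromThree W X →
        W.rootNumber * W.rootNumberThree = X.rootNumber * X.rootNumberThree) :
    KummerLineByRootNumberCongruentThree :=
  kummerLineByRootNumber_of_localSign h24 hC4 fun W _ => W.rootNumberThree_eq_one_or_eq_neg_one

/-! ## §A-O5-30 The RELATIVE local-sign law along a LOCAL mod-3 congruence (o5-r1 GEN 15, T32 §4; BKNO Thm 1.7)

APPEND-ONLY addition (cc-typer-5 GEN 11, 2026-08-22; ask **A-O5-30** of o5-r1 GEN 15, `HOME/INBOX.md` 2026-08-22T00:56Z,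
memo `HOME/b2b-bsdres-o5-r1/gen15/T32-TWIST-DESCENT-AND-SIGNS.md` §4 "Suggested typing: cited bridge
`RelKummerLineThreeCongruent : A[3] ≃[G_ℚ₃] B[3] → A(ℚ₃)[3] = 0 → (w₃ A · w₃ B = 1 ↔ κ A = κ B)` [BKNO Thm 1.7, Ex. 3,
Prop 1.5], next to `KummerLineByLocalRootNumberThree`"). Everything above this section is byte-identical (the import of
`O5.O5LocalShapeProofs` — harvest-2's `locIrr_three_iff_forall_not_isRoot`, theorems only — is the one added line).
PRINTED / ANNOUNCED ANTECEDENT (pages re-read by the typer, `lit read arxiv:2508.17776`): Burungale–Kobayashi–Nakamura–Ota,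
§1.2 **Thm. 1.7** (PDF p. 38): for `p` odd and `T₁, T₂` rank-two symplectic self-dual de Rham `𝒪_L`-representations of
`G_{ℚ_p}` that are residually symplectically isomorphic, `ε̂_p(V₁)/ε̂_p(V₂) = (−1)^{δ_p(T₁,T₂)}`; **Def. 1.4 / Example 3**
(p. 37): for elliptic curves `A, B/F_v` with `A[p] ≅ B[p]` as `𝔽_p[G_{F_v}]`-modules, `δ_v(A,B) = dim_{𝔽_p} Ā(F_v)/(Ā(F_v) ∩
B̄(F_v)) mod 2`, the Kummer images in `H¹(F_v, A[p])` compared through the given isomorphism; **Prop. 1.5** (p. 37): the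
constant does not depend on the isomorphism (in rank two every isomorphism scales the pairing). For elliptic curves the
`Γ`-factors agree (Hodge–Tate weights `{0,1}`), so `ε̂₃(V₃A)/ε̂₃(V₃B) = w₃(A)·w₃(B)`; with `A(ℚ₃)[3] = 0` (`H⁰ = 0`, the
"generic case" of the printed proof) `dim H¹(ℚ₃, A[3]) = 2`, `κ_A`, `κ_B` are LINES and `δ₃ = 0 ⟺ κ_A = κ_B`. Status:
PREPRINT (arXiv, August 2025) ⇒ ANNOUNCED ⇒ `@[conjecture]` node by the lane's rule; nothing asserted; 0 Literature facts.
DEDUP (`lean search` / tree grep): `RelKummerLineThreeCongruent`, `IsLocallyCongruentModThreeAt3` — no match; reused by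
name: `NoLocalThreeTorsionAt` (GEN 5), `numStableLinesAtThree` (GEN 4), `KummerTorsorsAgreeAtThree`, `IsKummerBasePointThree`,
`WeierstrassCurve.geomTorsion` (Literature `GaloisAction.lean`), `WeierstrassCurve.rootNumberThree`. -/

section RelativeLocalSign

/-- **LOCAL mod-3 congruence AT `3`**: `W[3] ≅ X[3]` as `G_{ℚ₃}`-MODULES — an additive isomorphism of the geometric
`3`-torsion of the base changes to `ℚ₃` commuting with `Gal(ℚ̄₃/ℚ₃)` (the tree's `geomTorsion`, `GaloisAction.lean`; the
shape of Literature's `Fisher2012.thm132_threeCongruent_hessePencil` with `ℚ` replaced by `ℚ₃`). This is BKNO's hypothesis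
("`A[p] ≅ B[p]` as `𝔽_p[G_{F_v}]`-modules", Example 3); in rank two it is automatically symplectic up to a scalar (Prop. 1.5).
It is implied by a GLOBAL `Γ_ℚ`-isomorphism `W[3] ≅ X[3]` (restriction to a decomposition group), hence by the census
predicate `IsCongruentModThree` when `W[3]` is irreducible (Brauer–Nesbitt + Chebotarev) — that step is the hypothesis
`hloc` of the bridge below, not asserted here. [cite: BurungaleKobayashiNakamuraOta2025, §1.1 Example 3 (arXiv 2508.17776, p. 37)] -/
def IsLocallyCongruentModThreeAt3 (W X : WeierstrassCurve ℚ) : Prop :=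
  ∃ e : (W.baseChange ℚ_[3]).geomTorsion 3 ≃+ (X.baseChange ℚ_[3]).geomTorsion 3,
    ∀ (σ : Field.absoluteGaloisGroup ℚ_[3]) (P : (W.baseChange ℚ_[3]).geomTorsion 3), e (σ • P) = σ • e P

/-- **A-O5-30 `RelKummerLineThreeCongruent` — the RELATIVE local-sign law (o5-r1 GEN 15, T32 §4; ANNOUNCED antecedent
[cite: BurungaleKobayashiNakamuraOta2025, Thm. 1.7 with Def. 1.4, Example 3 and Prop. 1.5 (arXiv 2508.17776, pp. 37–38; PREPRINT)];
`@[conjecture]` until the antecedent is refereed or a kernel proof lands; EVIDENCE-labelled; nothing asserted).** For elliptic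
curves `W, X/ℚ` whose `3`-torsion modules are isomorphic as `G_{ℚ₃}`-modules, with `W(ℚ₃)[3] = 0` (non-anomalous: then
`X(ℚ₃)[3] = 0` too, `dim_{𝔽₃} H¹(ℚ₃, W[3]) = 2` and both Kummer images are LINES) and `W[3]|G_{ℚ₃}` irreducible or NON-SPLIT
(at most one stable line): **the Kummer torsors at `3` agree iff the local root numbers at `3` have product `+1`**,
`κ_W = κ_X ⟺ w₃(W)·w₃(X) = 1` — ANY reduction types at `3` on either side, NO `LocIrr`, NO global irreducibility, NO clean
hypothesis. Reading of the print: Thm 1.7 gives `w₃(W)·w₃(X) = ε̂₃(V₃W)/ε̂₃(V₃X) = (−1)^{δ₃}` (`Γ`-factors agree), and by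
Example 3 `δ₃ = dim κ_W/(κ_W ∩ κ_X) ∈ {0,1}` is `0` iff the two lines coincide; `w₃ = W.rootNumberThree` is Rizzo's Table II
column (`= ±1` on every curve over `ℚ`: `rootNumberThree_eq_one_or_eq_neg_one`). CONSEQUENCES (o5-r1): with Lemma U
(`w₃ ≡ +1` on O5b) two 3-congruent O5b curves have the SAME Kummer line, and for `X` of another type congruent to `W ∈ O5b`,
`κ_X = κ_W ⟺ w₃(X) = +1`; absolute T24ℓ needs one reference curve per residual class instead of its `LocIrr` binder — and
T24ℓ itself follows from this node modulo the congruence-to-isomorphism step (`kummerLineByLocalRootNumberThree_of_rel`).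
TYPER NOTE (cc-typer-5 GEN 11; open to o5-r1's objection): the binder `numStableLinesAtThree W ≤ 1` is ADDED to the
planner's wording because the decidable shadow `KummerTorsorsAgreeAtThree` (GEN 5) expresses "`κ_W = κ_X` through the
isomorphism" only for `ρ̄|G_{ℚ₃}` irreducible or non-split (its own docstring); on a SPLIT non-anomalous `W[3]|G_{ℚ₃} ≅ χ₁ ⊕ χ₂`
the shadow cannot tell the two coordinate lines `H¹(ℚ₃, χ₁)`, `H¹(ℚ₃, χ₂)` apart, so BKNO's statement is not expressible by
it there (a finer shadow would be a new item). Why it might fail: only with BKNO Thm 1.7 / 1.3 (preprint) or the dictionary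
"cubic factor of `Λ_P` ⟺ `κ ∈ L_C`" behind the shadow; ONE locally 3-congruent non-anomalous pair with `≤ 1` stable line,
equal Table II signs and disagreeing torsors (or opposite signs and agreeing torsors) refutes it.
[evidence: census cell O5, o5-r1 GEN 15 T32: Lemma U w₃ ≡ +1 on O5b (quartic Gauss sum, by hand; = Table II III +1 / III* +1); Lemma T census 132/132 O5b + 28/28 O5a (kit j143970); no pair census of the relative law run (A-O5-31 asks P1–P3)] -/
@[conjecture] def RelKummerLineThreeCongruent : Prop :=
  ∀ (W X : WeierstrassCurve ℚ) [W.IsElliptic] [W.IsGloballyMinimal] [X.IsElliptic] [X.IsGloballyMinimal],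
    IsLocallyCongruentModThreeAt3 W X → NoLocalThreeTorsionAt W 3 → numStableLinesAtThree W ≤ 1 →
      ∀ x y x' y' : ℚ_[3], IsKummerBasePointThree W x y → IsKummerBasePointThree X x' y' →
        (KummerTorsorsAgreeAtThree W X x x' ↔ W.rootNumberThree * X.rootNumberThree = 1)

/-- `LocIrr W 3` (no stable line) ⟹ no `ℚ₃`-rational 3-torsion: an immediate reading of harvest-2's THEOREM
`locIrr_three_iff_forall_not_isRoot` (`O5/O5LocalShapeProofs.lean`: `LocIrr W 3 ↔ Ψ₃` has no root in `ℚ₃`) against GEN 5's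
polynomial predicate `NoLocalThreeTorsionAt` (no `ℚ₃`-root `x₀` of `Ψ₃` with `Ψ₂²(x₀)` a square). [folklore] -/
theorem noLocalThreeTorsionAt_three_of_locIrr (W : WeierstrassCurve ℚ) [W.IsElliptic] [W.IsGloballyMinimal]
    (hL : LocIrr W 3) : NoLocalThreeTorsionAt W 3 :=
  fun x₀ _ hx₀ _ => (locIrr_three_iff_forall_not_isRoot W).mp hL x₀ hx₀

/-- For Table II signs (`= ±1`), "product `+1`" is "equal". [folklore] -/
theorem rootNumberThree_mul_eq_one_iff (W X : WeierstrassCurve ℚ) [W.IsElliptic] [X.IsElliptic] :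
    W.rootNumberThree * X.rootNumberThree = 1 ↔ W.rootNumberThree = X.rootNumberThree := by
  rcases W.rootNumberThree_eq_one_or_eq_neg_one with hW | hW <;>
    rcases X.rootNumberThree_eq_one_or_eq_neg_one with hX | hX <;> simp [hW, hX]

/-- **Bridge (PROVED bookkeeping): A-O5-30 ⟹ T24ℓ, modulo the congruence-to-isomorphism step.** `hloc` is the printed
step "`W[3]` irreducible + `a_ℓ(W) ≡ a_ℓ(X) (mod 3)` at all good `ℓ ∤ 3N_WN_X` ⟹ `W[3] ≅ X[3]` as `Γ_ℚ`-modules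
(Brauer–Nesbitt, Chebotarev) ⟹ as `G_{ℚ₃}`-modules" — a hypothesis schema here (the tree has the census predicate
`IsCongruentModThree`, not the module isomorphism, as an object-level consequence). Given it, the relative law on the
`LocIrr` rows (no stable line, hence non-anomalous and `≤ 1` stable line — harvest-2's theorem) is exactly T24ℓ, the
product form `w₃w₃′ = 1` being equality of signs by `rootNumberThree_eq_one_or_eq_neg_one`. [folklore] -/
theorem kummerLineByLocalRootNumberThree_of_rel (hrel : RelKummerLineThreeCongruent)
    (hloc : ∀ (W X : WeierstrassCurve ℚ) [W.IsElliptic] [W.IsGloballyMinimal] [X.IsElliptic] [X.IsGloballyMinimal],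
      W.HasIrreducibleModPGaloisRep 3 → IsCongruentModThree W X → IsLocallyCongruentModThreeAt3 W X) :
    KummerLineByLocalRootNumberThree := by
  intro W X _ _ _ _ hL hρ hcong x y x' y' hx hx'
  have h0 : numStableLinesAtThree W ≤ 1 := by
    rw [(locIrr_three_iff_numStableLinesAtThree_eq_zero W).mp hL]; exact zero_le_one
  rw [hrel W X (hloc W X hρ hcong) (noLocalThreeTorsionAt_three_of_locIrr W hL) h0 x y x' y' hx hx']
  exact rootNumberThree_mul_eq_one_iff W X

end RelativeLocalSign

end Summit.BirchSwinnertonDyer.Rank1Residual.O5
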